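import Mathlib
import HarnessLib
import Summits.HubbardSuperconductivity.HubbardSuperconductivity.Theorems.KLProgrammeKLRegimeSplitGlue
import Summits.HubbardSuperconductivity.HubbardSuperconductivity.Theorems.KLProgrammeKLRegimeSplitGenericV3
import Summits.HubbardSuperconductivity.HubbardSuperconductivity.Theorems.KLProgrammeKLRegimeSplitBundleV6
import Summits.HubbardSuperconductivity.HubbardSuperconductivity.Theorems.KLProgrammeKLRegimeVolumeLimitDefs

/-!
# Route `KLProgramme` — the K3-NAMED glue of the FIVE v3 children of crux K3 `KLRegimeTwoPointLimit`
# (stmt-HubbardSuperconductivity-19937; DOWNSTREAM of the route file; cell gate-hubbard-kl, seat p2, g4)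

`KLRegimeInductionP3 (Pr) (VL)`: for EVERY predicate bundle `Pr : Preds` and EVERY volume-limit text `VL : VolLimitSlot`, the five generic
children of `KLProgrammeKLRegimeSplitGenericV3` on the covariance window — `EngineP3 Pr`, `BetaSplitP Pr`, `CountertermP2 Pr`,
`VolumeLimitP Pr VL`, `TwoPointAssemblyP3 Pr VL` at `klWindowC` — imply crux K3 `Theses.KLProgramme.KLRegimeTwoPointLimit` BY NAME
(`k3_twoPointLimit_of_childrenP3` + the route's S0 theorem `MuOfDopingWindow_holds`); and `KLRegimeInductionV6P3` = its specialisation to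
the bundle of record `klPredsV6` (`…SplitBundleV6`, p1b p448032) and the volume-limit constant `FinalTwoLegVolLimit` (hubbard-kl-r2d-p2's
`…KLRegimeVolumeLimitDefs`, p448970) — `KLRegimeInductionV6P3`, the closer the resplit's glue item cites (plan g10 13:27:45Z (3)); the `klPredsV7`
twin (Δ14) lives in `…SplitGlueV7P3`.  Nothing else is asserted.
-/

noncomputable section

namespace Summit.HubbardSuperconductivity.HubbardSuperconductivity.Theorems.KLRegimeSplit

set_option linter.dupNamespace false -- summit = problem name (single-conjunct summit), D-0017

/-- **The K3-named glue for the five v3 children, every bundle and every volume-limit text**: `EngineP3`, `BetaSplitP`, `CountertermP2`,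
`VolumeLimitP`, `TwoPointAssemblyP3` on the covariance window imply crux K3 `KLRegimeTwoPointLimit` BY NAME (constant staging
`G → P → R → Q → (c₀, c₁) → U₀`, strong induction to `n_β`, child 2's frame, the engine's last step `n_β + 1`, child 5's volume limits,
child 4; then S0 `MuOfDopingWindow_holds`). -/
theorem KLRegimeInductionP3 (Pr : Preds) (VL : VolLimitSlot) (h₃ : EngineP3 Pr klWindowC) (h₁ : BetaSplitP Pr klWindowC)
    (h₂ : CountertermP2 Pr klWindowC) (h₅ : VolumeLimitP Pr VL klWindowC) (h₄ : TwoPointAssemblyP3 Pr VL klWindowC) :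
    Summit.HubbardSuperconductivity.HubbardSuperconductivity.Theses.KLProgramme.KLRegimeTwoPointLimit :=
  k3_twoPointLimit_of_childrenP3 h₃ h₁ h₂ h₅ h₄
    Summit.HubbardSuperconductivity.HubbardSuperconductivity.Theses.KLProgramme.MuOfDopingWindow_holds

/-- **The K3-named glue at the bundle of record**: the five V6 children of record — `EngineP3 klPredsV6 klWindowC`,
`BetaSplitP klPredsV6 klWindowC`, `CountertermP2 klPredsV6 klWindowC`, `VolumeLimitP klPredsV6 FinalTwoLegVolLimit klWindowC`,
`TwoPointAssemblyP3 klPredsV6 FinalTwoLegVolLimit klWindowC` — imply crux K3 `KLRegimeTwoPointLimit` BY NAME. -/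
theorem KLRegimeInductionV6P3 :
    EngineP3 klPredsV6 klWindowC → BetaSplitP klPredsV6 klWindowC → CountertermP2 klPredsV6 klWindowC →
      VolumeLimitP klPredsV6 FinalTwoLegVolLimit klWindowC → TwoPointAssemblyP3 klPredsV6 FinalTwoLegVolLimit klWindowC →
        Summit.HubbardSuperconductivity.HubbardSuperconductivity.Theses.KLProgramme.KLRegimeTwoPointLimit :=
  KLRegimeInductionP3 klPredsV6 FinalTwoLegVolLimit

end Summit.HubbardSuperconductivity.HubbardSuperconductivity.Theorems.KLRegimeSplit

end
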